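import Literature.MathematicalPhysics.QuantumFieldTheory.Balaban1983to89.B1Prop21ZeroField
import Literature.MathematicalPhysics.QuantumFieldTheory.Balaban1983to89.B4ThmZeroTorusEta

/-!
# `Balaban1983to89.B1Prop21ZeroFieldTorus` — T. Bałaban, *(Higgs)₂,₃ quantum fields in a finite volume. I. A lower bound*,
# Commun. Math. Phys. **85** (1982) 603–626 [Balaban1982Higgs1]: **Proposition 2.1** (2.23)–(2.26) pp. 610–611 AT ZERO FIELD ON THE
# TORUS — the ruled reading (Hölder range `0 ≦ α < 1`) HOLDS on Bałaban's zero-field torus family `B4ThmZeroTorusEta.torusEtaFam`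
# (every volume, top level `K ≧ 1`, `Ω = Ω₀ = T_η`), by pv07's kernel bridge Prop. I.2.1 ≡ B4's Theorem p. 573 and p38's torus theorem;
# theorems only (gen 8's `B1Prop21ZeroField` booked the nested-box family, this file books the torus family)

statement-level skeleton of published theorems with citation tags; proofs where landed; nothing here is a claim about the Yang–Mills mass gap

PDF held: `paper:balaban1982-cmp85-higgs23-i` (journal page = PDF page + 602), pp. 610–611 [PDF 8–9] (Prop. 2.1; ×2 renders
`run/shared/lean/pub/pub-balaban/b2b-balaban-ref1/pages/1982-cmp85-higgs23-I/1982-cmp85-higgs23-I-p008|p009-x2.png`); companion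
`paper:balaban1983-cmp89-regularity-decay` (journal page = PDF page + 570), p. 572 [PDF 2] (the torus), p. 573 [PDF 3] (the Theorem
*"(Proposition 2.1 of [1])"*).

CITATION HEADER (lean-in-tree rule).  Cell `lit-balaban` (HOME `run/shared/lean/pub/lit-balaban/`), Phase-2 proof seat **p14** gen 9 (unit
`lit-balaban-p14`); SKELETON row **B1.Prop2.1** (decl of record `…B1.Prop21Printed`, pv07, UNCHANGED; fold owners r01/r14, referee ref-4);
kind «model instance + knitting».  EVERYTHING MATHEMATICAL BELOW IS AN EXISTING KERNEL THEOREM OF THE TREE, USED BY NAME: gen 8's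
`B1Prop21ZeroField.prop21NN_iff_thmPrintedNN` (the ruled reading of Prop. 2.1, written out, IS `B4Ineq111ZeroNestEta.ThmPrintedNN`) and
p38's `B4ThmZeroTorusEta.thmPrintedNN_torusEtaFam` (B4's Theorem p. 573, ruled reading, HOLDS hypothesis-free on the zero-field torus
family: (1.8) coercivity, (1.9) Hölder clause, (1.10) both value clauses, (1.11)–(1.12) with `δG = 0`).

WHAT IS PRINTED (I p. 610 [PDF 8], verbatim): *"**Proposition 2.1.** … Then for e(L^kε) sufficiently small and α < 1 there exist positive
constants δ₀, c₀, R₀ independent of A, k, Ω and depending on d, a, M only, c₀ on α also, such that for an arbitrary function f : Ω → R^N we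
have"* (2.24), (2.25), and (2.26) for `δG_k(Ω, Ω₀, A)`; B4 p. 572 [PDF 2]: *"Another common case is to consider operators on subsets of
a torus T_η which we identify with a rectangular parallelepiped in ηZ^d with periodic conditions"*; p. 573: *"For some simple sets Ω, e.g.
for rectangular parallelepipeds, the inequalities hold without any restrictions on the points x, x′"*.

WHAT THIS FILE PROVES (kernel-checked, zero `sorry`, NO `def`; axioms standard): **`prop21NN_torusEtaFam`** — for `d ≧ 1`, odd `L > 1`,
`a > 0`, `m² ≧ 0`, the ruled reading of Prop. 2.1 (the typed leaf `B1.Prop21Printed` with the binder `0 ≦ α` inserted: for every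
`0 ≦ α < 1` there are `δ₀, c₀, R₀, e₁ > 0` with (2.24)–(2.25) `B1.Ineq224_225` and (2.26) `B1.Ineq226` for every member) HOLDS on
`torusEtaFam d L a m²` — every volume `(m, K ≧ 1)` of Bałaban's scalar torus tower at its top level (`η = ε = L^{−K}`, `A = 0`, `U = 1`,
`N = d` components, `Ω = Ω₀ =` the whole torus); `prop21NN_torusEtaFam_member` (the clauses at one member).
HONEST SCOPE: `A = 0` only; `Ω = Ω₀ = T_η` (so the (2.26) clauses concern `δG = 0` and the boundary weights vanish — the *"rectangular
parallelepiped … without any restrictions"* branch); the literal leaf «∀ α < 1» is NOT asserted (its range defect is booked in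
`B1Prop21ZeroField`); the (Higgs)₂,₃ carrier reading of the value clause of (2.25) is in this seat's `B1Ineq225ZeroFieldTorusLevels`.
Unit `lit-balaban-p14` gen 9 (literature-prover-lit-balaban-p14-g9-0).
-/

namespace Literature.MathematicalPhysics.QuantumFieldTheory.Balaban1983to89.B1Prop21ZeroFieldTorus

open Literature.MathematicalPhysics.QuantumFieldTheory.Balaban1983to89.B1 (Ineq224_225 Ineq226)
open Literature.MathematicalPhysics.QuantumFieldTheory.Balaban1983to89.B1Prop21ZeroField (prop21NN_iff_thmPrintedNN)
open Literature.MathematicalPhysics.QuantumFieldTheory.Balaban1983to89.B4ThmZeroTorusEta (TorusEtaIdx torusEtaFam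
  thmPrintedNN_torusEtaFam)

/-- **PROP. 2.1, RULED READING `0 ≦ α < 1`, HOLDS AT ZERO FIELD ON BAŁABAN'S TORUS FAMILY**: for `d ≧ 1`, odd `L > 1`, `a > 0`, `m² ≧ 0`
and every `0 ≦ α < 1` there are `δ₀, c₀, R₀, e₁ > 0` such that every member of `torusEtaFam d L a m²` (every volume, top level `K ≧ 1`,
`Ω = Ω₀ = T_η`) satisfies (2.24)–(2.25) (`B1.Ineq224_225`) and (2.26) (`B1.Ineq226`) — gen 8's bridge `prop21NN_iff_thmPrintedNN` applied to
p38's `thmPrintedNN_torusEtaFam`. [cite: Balaban1982Higgs1, Prop. 2.1 (2.23)–(2.26) pp.610–611] -/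
theorem prop21NN_torusEtaFam (d L : ℕ) (hd : 1 ≤ d) (hL : Odd L ∧ 1 < L) {a : ℝ} (ha : 0 < a) {msq : ℝ} (hmsq : 0 ≤ msq) :
    ∀ α : ℝ, 0 ≤ α → α < 1 → ∃ δ₀ c₀ R₀ e₁ : ℝ, 0 < δ₀ ∧ 0 < c₀ ∧ 0 < R₀ ∧ 0 < e₁ ∧ ∀ i : TorusEtaIdx d L,
      (torusEtaFam d L a msq i).regular → (torusEtaFam d L a msq i).bigBlocks →
        0 < (torusEtaFam d L a msq i).e → (torusEtaFam d L a msq i).e ≤ e₁ →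
          Ineq224_225 (torusEtaFam d L a msq i) α δ₀ c₀ R₀ ∧ Ineq226 (torusEtaFam d L a msq i) α δ₀ c₀ R₀ :=
  (prop21NN_iff_thmPrintedNN _).2 (thmPrintedNN_torusEtaFam d L hd hL ha hmsq)

/-- **One member**: for a volume `(m, K ≧ 1)` of the torus family with charge index `0 < e ≦ e₁(α)`, the clauses (2.24)–(2.26) hold with
the family's constants (the hypotheses `regular`, `bigBlocks` of a torus member are `True`). [cite: Balaban1982Higgs1, Prop. 2.1 (2.24)–(2.26) p.610] -/
theorem prop21NN_torusEtaFam_member (d L : ℕ) (hd : 1 ≤ d) (hL : Odd L ∧ 1 < L) {a : ℝ} (ha : 0 < a) {msq : ℝ}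
    (hmsq : 0 ≤ msq) {α : ℝ} (hα0 : 0 ≤ α) (hα1 : α < 1) :
    ∃ δ₀ c₀ R₀ e₁ : ℝ, 0 < δ₀ ∧ 0 < c₀ ∧ 0 < R₀ ∧ 0 < e₁ ∧ ∀ i : TorusEtaIdx d L, 0 < i.e → i.e ≤ e₁ →
      Ineq224_225 (torusEtaFam d L a msq i) α δ₀ c₀ R₀ ∧ Ineq226 (torusEtaFam d L a msq i) α δ₀ c₀ R₀ := by
  obtain ⟨δ₀, c₀, R₀, e₁, hδ, hc, hR, he, H⟩ := prop21NN_torusEtaFam d L hd hL ha hmsq α hα0 hα1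
  exact ⟨δ₀, c₀, R₀, e₁, hδ, hc, hR, he, fun i hi0 hi1 => H i trivial trivial hi0 hi1⟩

/-- Non-vacuity for the record: `d = 3`, `L = 3`, `a = 1`, `m² = 0`, `α = ½`. [cite: Balaban1982Higgs1, Prop. 2.1 p.610] -/
example : ∃ δ₀ c₀ R₀ e₁ : ℝ, 0 < δ₀ ∧ 0 < c₀ ∧ 0 < R₀ ∧ 0 < e₁ ∧ ∀ i : TorusEtaIdx 3 3, 0 < i.e → i.e ≤ e₁ →
    Ineq224_225 (torusEtaFam 3 3 1 0 i) (1 / 2) δ₀ c₀ R₀ ∧ Ineq226 (torusEtaFam 3 3 1 0 i) (1 / 2) δ₀ c₀ R₀ :=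
  prop21NN_torusEtaFam_member 3 3 (by norm_num) ⟨⟨1, by norm_num⟩, by norm_num⟩ one_pos le_rfl (by norm_num) (by norm_num)

end Literature.MathematicalPhysics.QuantumFieldTheory.Balaban1983to89.B1Prop21ZeroFieldTorus
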